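import Summits.QuantumAdvantage.QuantumAdvantage.Theorems.OddPrimeWalkZeroSumPairs

/-!
# The CLASS-BLIND pair law of the u-walk game (engine for item stmt-QuantumAdvantage-24150 `FewFormsPairLaw`)

Cell qa-qnc0, route OddPrimeWalk (support, rank 9); planner qa-qnc0-p2 g30 (ROUND-30 §3.9, THM 30-E, brief P2-30f);
prover qn-prover-3 g19 (this abstraction and its proof are the prover's simplification of the planner's randomised-design argument:
no ground block, no gadget, no density bookkeeping).

SETTING.  The u-walk game `ringWinU c y` across a separator `m`; `A`-parts `s ∈ Aset n m` (bits `< m`), `B`-parts `t ∈ Bset n m`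
(bits `≥ m`), inputs `glue m s t`.  Two ARBITRARY labellings `κA : inputs → ΛA` ("what Bob's cuts may learn about Alice's half")
and `κB : inputs → ΛB`.  HYPOTHESES: every cut `g ≤ m` is a function of (Alice's half, `κB` of Bob's half) — `hA`; every cut `g > m`
is a function of (Bob's half, `κA` of Alice's half) — `hB`.  CELLS: `cellA l a` = the `A`-parts with label `l` and weight `≡ a (mod 3)`;
`minCellA l` = the smallest of the three cells of label `l`; the BALANCE of a side is `Σ_l minCell l`.

THEOREM `classBlind_mul_le_card_lose`:  `(Σ_l minCellA l) · (Σ_l' minCellB l') ≤ 9 · #LOSE`.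

PROOF.  §1 `classes_exists_lose`: one point per cell inside ONE label class on each side is an odd configuration satisfying the
hypotheses of the planner's `configParity` (a cut `g ≤ m` fires identically on the three Bob points — same label — so every Bob class
count is the same bit; symmetrically), hence has a LOST glued pair; this is `blind_exists_lose` with class-constancy in place of
blindness.  §2 `minCell_mul_le_card_lost`: parametrise `minCell` points of each cell by `Fin (minCell)` (`pick`, injective); every
parameter pair `(i, i') ∈ Fin nA × Fin nB` has a lost slot pair among the `9`, and each slot pair is injective in the parameters, so
`nA · nB ≤ 9 · #{lost (s, t) in the two label classes}` (the double count of `pow_le_card_lose_design`, p698126).  §3 sum over label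
pairs; the lost `(s, t)` of distinct label pairs are distinct, and `(s, t) ↦ glue m s t` is a bijection onto the inputs.
CONSUMER: `FewFormsPairLaw` (stmt-24150): cuts reading the other side through `≤ s` listed linear forms mod `5` are functions of the
mod-`5` SIGNATURE of the other half, whose cells are balanced by the two-moduli exponential-sum bound (file `OddPrimeWalkSignatureBalance`).
`BlindPairLaw` (stmt-23990) is the case of constant labels.
WHAT THIS IS NOT: instrument; no statement about dense unstructured reading (cruxes 23029/23109 untouched); separation NOT moved.
-/

namespace Summit.QuantumAdvantage.AdviceFreeQNC0.OddConfig

open Finset Classical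

variable {n : ℕ}

/-! ### §1 One point per cell inside one label class: the configuration has a lost pair -/

section Grid

variable {ΛA ΛB : Type}

/-- **Class-blind corollary of `configParity`.**  If cuts `g ≤ m` see Bob's half only through `κB` and cuts `g > m` see Alice's
half only through `κA`, then for any system of weight-class representatives `p a` (class `a`, all with the SAME label) and `q b`
(class `b`, all with the same label) one of the nine glued pairs is lost. -/
theorem classes_exists_lose (m c : ℕ) (y : Fin (n + 1) → (Fin n → Bool) → Bool)
    (κA : (Fin n → Bool) → ΛA) (κB : (Fin n → Bool) → ΛB)
    (hA : ∀ g : Fin (n + 1), g.val ≤ m → ∀ s t t' : Fin n → Bool, κB t = κB t' →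
      y g (glue m s t) = y g (glue m s t'))
    (hB : ∀ g : Fin (n + 1), m < g.val → ∀ s s' t : Fin n → Bool, κA s = κA s' →
      y g (glue m s t) = y g (glue m s' t))
    (p q : Fin 3 → Fin n → Bool) (hp : ∀ a, wtA m (p a) % 3 = a.val) (hq : ∀ b, wtB m (q b) % 3 = b.val)
    (hκp : ∀ a, κA (p a) = κA (p 0)) (hκq : ∀ b, κB (q b) = κB (q 0)) :
    ∃ a b, ringWinU c y (glue m (p a) (q b)) = false := by
  refine configParity m c y p q (by simp) (by simp) ?_ ?_
  · intro g hg i b hb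
    have hF : ∀ j, y g (glue m (p i) (q j)) = y g (glue m (p i) (q 0)) := fun j => hA g hg _ _ _ (hκq j)
    simp_rw [hF, hq]
    by_cases hC : y g (glue m (p i) (q 0)) = true
    · simp only [hC, and_true]
      interval_cases b <;> decide
    · simp [hC]
  · intro g hg j a ha
    have hF : ∀ i, y g (glue m (p i) (q j)) = y g (glue m (p 0) (q j)) := fun i => hB g hg _ _ _ (hκp i)
    simp_rw [hF, hp]
    by_cases hC : y g (glue m (p 0) (q j)) = true
    · simp only [hC, and_true]
      interval_cases a <;> decide
    · simp [hC]

end Grid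

/-! ### §2 Cells, their injective parametrisation, and the per-class-pair count -/

/-- an injective parametrisation of `k ≤ |S|` points of the finset `S` by `Fin k`. -/
noncomputable def pick (S : Finset (Fin n → Bool)) {k : ℕ} (hk : k ≤ S.card) (i : Fin k) : Fin n → Bool :=
  (S.equivFin.symm (Fin.castLE hk i)).1

/-- `pick` lands in `S`. -/
theorem pick_mem (S : Finset (Fin n → Bool)) {k : ℕ} (hk : k ≤ S.card) (i : Fin k) : pick S hk i ∈ S :=
  (S.equivFin.symm (Fin.castLE hk i)).2

/-- `pick` is injective. -/
theorem pick_injective (S : Finset (Fin n → Bool)) {k : ℕ} (hk : k ≤ S.card) : Function.Injective (pick S hk) := by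
  intro i j h
  have h1 : S.equivFin.symm (Fin.castLE hk i) = S.equivFin.symm (Fin.castLE hk j) := Subtype.ext h
  exact Fin.castLE_injective hk (S.equivFin.symm.injective h1)

section Cells

variable {ΛA ΛB : Type} (m : ℕ) (κA : (Fin n → Bool) → ΛA) (κB : (Fin n → Bool) → ΛB)

/-- Alice cell: the `A`-parts with label `l` and `A`-weight `≡ a (mod 3)`. -/
noncomputable def cellA (l : ΛA) (a : ℕ) : Finset (Fin n → Bool) := (Aset n m).filter fun s => κA s = l ∧ wtA m s % 3 = a

/-- Bob cell: the `B`-parts with label `l'` and `B`-weight `≡ b (mod 3)`. -/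
noncomputable def cellB (l' : ΛB) (b : ℕ) : Finset (Fin n → Bool) := (Bset n m).filter fun t => κB t = l' ∧ wtB m t % 3 = b

/-- the size of the smallest of the three Alice cells of label `l`. -/
noncomputable def minCellA (l : ΛA) : ℕ := min (min (cellA m κA l 0).card (cellA m κA l 1).card) (cellA m κA l 2).card

/-- the size of the smallest of the three Bob cells of label `l'`. -/
noncomputable def minCellB (l' : ΛB) : ℕ := min (min (cellB m κB l' 0).card (cellB m κB l' 1).card) (cellB m κB l' 2).card

/-- `minCellA` is below every cell size. -/
theorem minCellA_le (l : ΛA) (a : Fin 3) : minCellA m κA l ≤ (cellA m κA l a.val).card := by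
  unfold minCellA
  have ha : a = 0 ∨ a = 1 ∨ a = 2 := by fin_cases a <;> simp
  rcases ha with rfl | rfl | rfl <;> simp only [Fin.isValue, Fin.val_zero, Fin.val_one, Fin.val_two] <;> omega

/-- `minCellB` is below every cell size. -/
theorem minCellB_le (l' : ΛB) (b : Fin 3) : minCellB m κB l' ≤ (cellB m κB l' b.val).card := by
  unfold minCellB
  have hb : b = 0 ∨ b = 1 ∨ b = 2 := by fin_cases b <;> simp
  rcases hb with rfl | rfl | rfl <;> simp only [Fin.isValue, Fin.val_zero, Fin.val_one, Fin.val_two] <;> omega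

/-- the lost glued pairs `(s, t) ∈ Aset × Bset`. -/
def lostPairs (c : ℕ) (y : Fin (n + 1) → (Fin n → Bool) → Bool) : Finset ((Fin n → Bool) × (Fin n → Bool)) :=
  (Aset n m ×ˢ Bset n m).filter fun st => ringWinU c y (glue m st.1 st.2) = false

/-- **Per-class-pair count.**  For labels `l, l'`: `minCellA l · minCellB l' ≤ 9 · #{lost (s, t) : κA s = l, κB t = l'}`. -/
theorem minCell_mul_le_card_lost (c : ℕ) (y : Fin (n + 1) → (Fin n → Bool) → Bool)
    (hA : ∀ g : Fin (n + 1), g.val ≤ m → ∀ s t t' : Fin n → Bool, κB t = κB t' →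
      y g (glue m s t) = y g (glue m s t'))
    (hB : ∀ g : Fin (n + 1), m < g.val → ∀ s s' t : Fin n → Bool, κA s = κA s' →
      y g (glue m s t) = y g (glue m s' t))
    (l : ΛA) (l' : ΛB) :
    minCellA m κA l * minCellB m κB l' ≤
      9 * ((lostPairs m c y).filter fun st => (κA st.1, κB st.2) = (l, l')).card := by
  set nA := minCellA m κA l with hnA
  set nB := minCellB m κB l' with hnB
  have hpA : ∀ a : Fin 3, nA ≤ (cellA m κA l a.val).card := minCellA_le m κA l
  have hpB : ∀ b : Fin 3, nB ≤ (cellB m κB l' b.val).card := minCellB_le m κB l'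
  set P : Fin 3 → Fin nA → Fin n → Bool := fun a => pick (cellA m κA l a.val) (hpA a) with hP
  set Q : Fin 3 → Fin nB → Fin n → Bool := fun b => pick (cellB m κB l' b.val) (hpB b) with hQ
  have hPmem : ∀ a i, P a i ∈ Aset n m ∧ κA (P a i) = l ∧ wtA m (P a i) % 3 = a.val := by
    intro a i
    have h := pick_mem (cellA m κA l a.val) (hpA a) i
    simp only [cellA, mem_filter] at h
    exact ⟨h.1, h.2.1, h.2.2⟩
  have hQmem : ∀ b i, Q b i ∈ Bset n m ∧ κB (Q b i) = l' ∧ wtB m (Q b i) % 3 = b.val := by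
    intro b i
    have h := pick_mem (cellB m κB l' b.val) (hpB b) i
    simp only [cellB, mem_filter] at h
    exact ⟨h.1, h.2.1, h.2.2⟩
  set R : (Fin nA × Fin nB) → (Fin 3 × Fin 3) → Prop :=
    fun x ab => ringWinU c y (glue m (P ab.1 x.1) (Q ab.2 x.2)) = false with hR
  -- (1) every parameter pair has a lost slot pair
  have h1 : ∀ x : Fin nA × Fin nB, 1 ≤ (univ.filter fun ab => R x ab).card := by
    intro x
    obtain ⟨a, b, hab⟩ := classes_exists_lose m c y κA κB hA hB (fun a => P a x.1) (fun b => Q b x.2)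
      (fun a => (hPmem a x.1).2.2) (fun b => (hQmem b x.2).2.2)
      (fun a => by rw [(hPmem a x.1).2.1, (hPmem 0 x.1).2.1]) (fun b => by rw [(hQmem b x.2).2.1, (hQmem 0 x.2).2.1])
    exact card_pos.mpr ⟨(a, b), mem_filter.mpr ⟨mem_univ _, hab⟩⟩
  -- (2) each slot pair is injective in the parameters and lands in the lost pairs of the two label classes
  have h2 : ∀ ab : Fin 3 × Fin 3, (univ.filter fun x => R x ab).card ≤
      ((lostPairs m c y).filter fun st => (κA st.1, κB st.2) = (l, l')).card := by
    intro ab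
    refine card_le_card_of_injOn (fun x => (P ab.1 x.1, Q ab.2 x.2)) ?_ ?_
    · intro x hx
      have h := (mem_filter.mp (mem_coe.mp hx)).2
      refine mem_coe.mpr (mem_filter.mpr ⟨mem_filter.mpr ⟨mem_product.mpr ⟨(hPmem ab.1 x.1).1, (hQmem ab.2 x.2).1⟩, h⟩, ?_⟩)
      rw [(hPmem ab.1 x.1).2.1, (hQmem ab.2 x.2).2.1]
    · intro x _ x' _ he
      obtain ⟨ha, hb⟩ := Prod.mk.inj he
      exact Prod.ext (pick_injective _ _ ha) (pick_injective _ _ hb)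
  -- (3) double count
  calc nA * nB
      = (univ : Finset (Fin nA × Fin nB)).card := by rw [card_univ, Fintype.card_prod, Fintype.card_fin, Fintype.card_fin]
    _ = ∑ x : Fin nA × Fin nB, 1 := by rw [sum_const, smul_eq_mul, mul_one]
    _ ≤ ∑ x : Fin nA × Fin nB, (univ.filter fun ab => R x ab).card := sum_le_sum fun x _ => h1 x
    _ = ∑ ab : Fin 3 × Fin 3, (univ.filter fun x => R x ab).card := by simp_rw [card_filter]; exact sum_comm
    _ ≤ ∑ ab : Fin 3 × Fin 3, ((lostPairs m c y).filter fun st => (κA st.1, κB st.2) = (l, l')).card :=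
        sum_le_sum fun ab _ => h2 ab
    _ = _ := by rw [sum_const, smul_eq_mul, card_univ, Fintype.card_prod, Fintype.card_fin]

end Cells

/-! ### §3 Summing over label pairs: the class-blind pair law -/

/-- the lost glued pairs are in bijection with the lost inputs. -/
theorem card_lostPairs (m c : ℕ) (y : Fin (n + 1) → (Fin n → Bool) → Bool) :
    (lostPairs m c y).card = (univ.filter fun u : Fin n → Bool => ¬ ringWinU c y u = true).card := by
  refine card_nbij' (fun st => glue m st.1 st.2) (fun u => (loPart m u, hiPart m u)) ?_ ?_ ?_ ?_
  · intro st hst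
    have h := (mem_filter.mp (mem_coe.mp hst)).2
    exact mem_coe.mpr (mem_filter.mpr ⟨mem_univ _, by rw [h]; exact Bool.false_ne_true⟩)
  · intro u hu
    have h := (mem_filter.mp (mem_coe.mp hu)).2
    refine mem_coe.mpr (mem_filter.mpr ⟨mem_product.mpr ⟨loPart_mem_Aset m u, hiPart_mem_Bset m u⟩, ?_⟩)
    rw [glue_loPart_hiPart]
    simpa using h
  · intro st hst
    obtain ⟨hs, ht⟩ := mem_product.mp (mem_filter.mp (mem_coe.mp hst)).1
    exact Prod.ext (loPart_glue hs st.2) (hiPart_glue ht st.1)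
  · intro u _; exact glue_loPart_hiPart m u

/-- **THE CLASS-BLIND PAIR LAW.**  If every cut `g ≤ m` sees Bob's half only through the label `κB` and every cut `g > m` sees
Alice's half only through `κA` (own halves arbitrary), then `(Σ_l minCellA l) · (Σ_l' minCellB l') ≤ 9 · #LOSE`. -/
theorem classBlind_mul_le_card_lose {ΛA ΛB : Type} [Fintype ΛA] [Fintype ΛB] (m c : ℕ)
    (y : Fin (n + 1) → (Fin n → Bool) → Bool) (κA : (Fin n → Bool) → ΛA) (κB : (Fin n → Bool) → ΛB)
    (hA : ∀ g : Fin (n + 1), g.val ≤ m → ∀ s t t' : Fin n → Bool, κB t = κB t' →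
      y g (glue m s t) = y g (glue m s t'))
    (hB : ∀ g : Fin (n + 1), m < g.val → ∀ s s' t : Fin n → Bool, κA s = κA s' →
      y g (glue m s t) = y g (glue m s' t)) :
    (∑ l, minCellA m κA l) * (∑ l', minCellB m κB l') ≤
      9 * (univ.filter fun u : Fin n → Bool => ¬ ringWinU c y u = true).card := by
  rw [sum_mul_sum, ← card_lostPairs m c y,
    card_eq_sum_card_fiberwise (f := fun st : (Fin n → Bool) × (Fin n → Bool) => (κA st.1, κB st.2))
      (s := lostPairs m c y) (t := (univ : Finset (ΛA × ΛB))) (fun _ _ => mem_univ _),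
    mul_sum, Fintype.sum_prod_type]
  exact sum_le_sum fun l _ => sum_le_sum fun l' _ => minCell_mul_le_card_lost m κA κB c y hA hB l l'

end Summit.QuantumAdvantage.AdviceFreeQNC0.OddConfig
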